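import Literature.Probability.TransportMaps.DobrushinCouplingCompact
import Literature.Probability.TransportMaps.DobrushinPecherskySweep
import Literature.Probability.TransportMaps.TVDisagreement
import HarnessLib
/-!
# The Dobrushin–Pechersky one-step estimates: resampling one site through a total-variation
# coupling, with bad boundary conditions charged to a Lyapunov function
# (Conache–Kondratiev–Kozitsky–Pasurek 2015, Lemma 3.6, (21)–(24)), and their colour-class sweep
# (Lemma 3.7) for one-site total-variation couplings

[topic Probability/TransportMaps]

Two parts. PART I (namespace `DobrushinPecherskyStep`): the one-step estimates (21)–(24).
PART II (namespace `DobrushinPecherskySweepTV`, second sectioning docstring below): the TV systems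
`tvSystem`, `isDPStep_tvSystem`, ★ `lemma_3_7_tv`, `isCoupling_sweep_tv`.

D. Conache, Yu. Kondratiev, Yu. Kozitsky, T. Pasurek, *Gibbs Fields: Uniqueness and Decay of
Correlations. Revisiting Dobrushin and Pechersky*, arXiv:1501.00673 (2015) [ConacheEtAl2015] — the refined proof of
the Dobrushin–Pechersky criterion (R. L. Dobrushin, E. A. Pechersky, LNM 1021 (1983) [DobrushinPechersky1983]). Setting
(§2.1–2.2, verbatim up to notation): a graph with neighbourhoods `∂ℓ`; a one-site specification
`π_ℓ^x`; the discrete cost `υ(ξ, η) = 𝟙{ξ ≠ η}`; measurable maximal couplings `ϱ_ℓ^{x,y}` of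
`π_ℓ^x, π_ℓ^y` (Prop. 2.3); hypotheses (10) `d(π_ℓ^x, π_ℓ^y) ≤ Σ_{ℓ'∈∂ℓ} κ_{ℓℓ'} υ(x_{ℓ'}, y_{ℓ'})`
for `x, y ∈ X_ℓ(h, K) = {x : h(x_{ℓ'}) ≤ K ∀ ℓ' ∈ ∂ℓ}` (11), and (12)
`π_ℓ^x(h) ≤ 1 + Σ_{ℓ'∈∂ℓ} c_{ℓℓ'} h(x_{ℓ'})`; the resampling map (16)
`(R_ℓ ν)(f) = ∫ (∫ f(ξ × x_{ℓ^c}, η × y_{ℓ^c}) ϱ_ℓ^{x,y}(dξ, dη)) ν(dx, dy)`; the functionals (19)–(20)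
`I_ℓ(x¹, x²) = υ(x¹_ℓ, x²_ℓ)`, `H^i_ℓ(x¹, x²) = h(x^i_ℓ)`.

**Lemma 3.6** (verbatim): «Let `ν ∈ 𝒫(X²)` be such that the integrals on both sides of (16) exist
for `f = H^i_ℓ` … Then the following estimates hold
(21) `(R_ℓ ν)(I_ℓ) ≤ Σ_{ℓ'∈∂ℓ} κ_{ℓℓ'} ν(I_{ℓ'}) + K⁻¹ Σ_{i=1,2} Σ_{ℓ₁,ℓ₂∈∂ℓ} ν(I_{ℓ₂} H^i_{ℓ₁})`,
(22) `(R_ℓ ν)(I_{ℓ₁} H^i_ℓ) ≤ ν(I_{ℓ₁}) + Σ_{ℓ₂∈∂ℓ} c_{ℓℓ₂} ν(I_{ℓ₁} H^i_{ℓ₂})`,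
(23) `(R_ℓ ν)(I_ℓ H^i_{ℓ₁}) ≤ Σ_{ℓ₂∈∂ℓ} ν(I_{ℓ₂} H^i_{ℓ₁})`, `ℓ₁ ≠ ℓ`,
(24) `(R_ℓ ν)(I_ℓ H^i_ℓ) ≤ Σ_{ℓ₁∈∂ℓ} ν(I_{ℓ₁}) + Σ_{ℓ₁,ℓ₂∈∂ℓ} c_{ℓℓ₂} ν(I_{ℓ₁} H^i_{ℓ₂})`.»
The mechanism of (21) (proof, p. 9): on GOOD pairs use (10); on the complement
«`1 − 𝟙_ℓ(x¹)𝟙_ℓ(x²) ≤ Σ_{i} Σ_{ℓ₁∈∂ℓ} [1 − 𝟙_{h≤K}(x^i_{ℓ₁})] ≤ K⁻¹ Σ h(x^i_{ℓ₁})`» (Markov) together with the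
locality bound `d(π_ℓ^{x¹}, π_ℓ^{x²}) ≤ Σ_{ℓ₂∈∂ℓ} I_{ℓ₂}` (Lemma 3.5): a bad boundary condition costs
`K⁻¹ · (disagreement × h)`, NOT its probability — which is what lets Dobrushin–Pechersky absorb bad
sets at an exponential rate (Lemma 3.7 — Part II of this file — and Thms. 2.6–2.7, not in this file).

THIS FILE proves (21)–(24) for finitely many sites `ι` in the tree's vocabulary: the resampling
map is `DobrushinCouplingCompact.resample (q ℓ) ℓ ν` for ANY Markov one-site coupling kernels
`q ℓ : (Ω × Ω) → 𝒫(S × S)`, the cost is `TVDisagreement.tvCost`, and the printed hypotheses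
become: LOCALITY `hdiag` (boundary conditions agreeing on `∂ℓ` ⇒ `q_ℓ` charges no disagreement —
for the maximal coupling of a nearest-neighbour specification this is `π_ℓ^x = π_ℓ^y`), the GOOD-PAIR
row `hgood` (= (10)–(11)), and the LYAPUNOV rows `hlyap₁`, `hlyap₂` (= (12) for the two marginals,
possibly with different matrices `c`, `c'` — two specifications are allowed, as needed for
comparison theorems). Everything is `ℝ≥0∞`-valued (no integrability side conditions).

* `lintegral_tvCost_le_sum_of_local` — Lemma 3.5's bound `∫ υ dq_ℓ(x,y) ≤ Σ_{ℓ'∈∂ℓ} I_{ℓ'}(x,y)`;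
* `dp21`, `dp22₁`/`dp22₂`, `dp23`, `dp24₁`/`dp24₂` — the four estimates.

Scope (honest): Part I (namespace `DobrushinPecherskyStep`) is ONE resampling step, finite `ι`;
Part II below (namespace `DobrushinPecherskySweepTV`, with its own sectioning docstring) feeds these
estimates to the abstract colour-class sweep of `DobrushinPecherskySweep` (Lemma 3.7 in TV currency);
the contraction matrix `M(K)` and Theorems 2.6/2.7 are NOT here (blueprint:
`HOME/ym3ir/DP-BLUEPRINT-lit-g14.md` of the pub-ymgap cell). No named facts.

## References
* D. Conache, Yu. Kondratiev, Yu. Kozitsky, T. Pasurek, arXiv:1501.00673 (2015), §3.2 Lemma 3.6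
  (21)–(24), Lemma 3.5, Prop. 2.3 [ConacheEtAl2015] — statements quoted from the held TeX,
  `paper:arxiv-1501.00673` pp. 8–9.
* R. L. Dobrushin, E. A. Pechersky, *A criterion of the uniqueness of Gibbsian fields in the
  non-compact case*, LNM 1021 (1983) 97–110.
* E. Presutti, *Scaling Limits in Statistical Mechanics and Microstructures in Continuum Mechanics*
  (Springer 2009), §3.2.2 (the resampling map (3.2.2.4)). [Presutti2009]
-/

noncomputable section

open MeasureTheory ProbabilityTheory Filter Function Set Finset
open scoped ENNReal NNReal

namespace Literature.Probability.TransportMaps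

namespace DobrushinPecherskyStep

open DobrushinCouplingCompact (resample lintegral_resample)
open TVDisagreement (tvCost tvCost_self tvCost_le_one measurable_tvCost measurable_tvCost_coord)

variable {ι : Type*} [Fintype ι] [DecidableEq ι]
variable {S : Type*} [MeasurableSpace S]
variable (q : ι → Kernel ((ι → S) × (ι → S)) (S × S)) [∀ ℓ, IsMarkovKernel (q ℓ)]
variable (nbr : ι → Finset ι)

/-! ### Locality: Lemma 3.5 -/

omit [Fintype ι] [DecidableEq ι] in
/-- **Lemma 3.5 (locality bound).** If the one-site coupling charges no disagreement whenever the
two boundary conditions agree on `∂ℓ` («for such `(x¹, x²)` … `π_ℓ^{x¹} = π_ℓ^{x²}`, and hence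
`∫ υ dϱ_ℓ^{x¹,x²} = d(π_ℓ^{x¹}, π_ℓ^{x²}) = 0`»), then always
`∫ υ dq_ℓ(x¹, x²) ≤ Σ_{ℓ'∈∂ℓ} υ(x¹_{ℓ'}, x²_{ℓ'})`. [cite: ConacheEtAl2015, Lemma 3.5; discrete cost as in Presutti2009 §3.2.3 Cor. 3.2.3.2] -/
theorem lintegral_tvCost_le_sum_of_local (ℓ : ι)
    (hdiag : ∀ p : (ι → S) × (ι → S), (∀ ℓ' ∈ nbr ℓ, p.1 ℓ' = p.2 ℓ') →
      ∫⁻ s, tvCost S s ∂(q ℓ p) = 0)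
    (p : (ι → S) × (ι → S)) :
    ∫⁻ s, tvCost S s ∂(q ℓ p) ≤ ∑ ℓ' ∈ nbr ℓ, tvCost S (p.1 ℓ', p.2 ℓ') := by
  by_cases hagree : ∀ ℓ' ∈ nbr ℓ, p.1 ℓ' = p.2 ℓ'
  · rw [hdiag p hagree]; exact bot_le
  · push Not at hagree
    obtain ⟨ℓ', hℓ', hne⟩ := hagree
    calc ∫⁻ s, tvCost S s ∂(q ℓ p) ≤ ∫⁻ _, 1 ∂(q ℓ p) := lintegral_mono fun s => tvCost_le_one s
      _ = 1 := by rw [lintegral_const, measure_univ, mul_one]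
      _ = tvCost S (p.1 ℓ', p.2 ℓ') := by
          rw [tvCost, indicator_of_mem (by simpa [Set.mem_diagonal_iff] using hne)]; rfl
      _ ≤ ∑ ℓ'' ∈ nbr ℓ, tvCost S (p.1 ℓ'', p.2 ℓ'') :=
          single_le_sum (f := fun ℓ'' => tvCost S (p.1 ℓ'', p.2 ℓ'')) (fun _ _ => bot_le) hℓ'

/-! ### (23): resampling `ℓ` moves the disagreement at `ℓ` onto its neighbours -/

omit [Fintype ι] in
/-- **(23), general form.** For a measurable weight `F ≥ 0` that does not read the coordinates at `ℓ`
(e.g. `F = H^i_{ℓ₁}`, `ℓ₁ ≠ ℓ`): `∫ I_ℓ · F d(R_ℓ ν) ≤ ∫ (Σ_{ℓ₂∈∂ℓ} I_{ℓ₂}) · F dν`.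
[cite: ConacheEtAl2015, Lemma 3.6 (23); resampling map = Presutti2009 §3.2.2 (3.2.2.4)] -/
theorem dp23 (hΔ : MeasurableSet (Set.diagonal S)) (ℓ : ι)
    (hdiag : ∀ p : (ι → S) × (ι → S), (∀ ℓ' ∈ nbr ℓ, p.1 ℓ' = p.2 ℓ') →
      ∫⁻ s, tvCost S s ∂(q ℓ p) = 0)
    (ν : Measure ((ι → S) × (ι → S))) [SFinite ν] {F : (ι → S) × (ι → S) → ℝ≥0∞}
    (hF : Measurable F) (hFinv : ∀ ω ω' s s', F (update ω ℓ s, update ω' ℓ s') = F (ω, ω')) :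
    ∫⁻ x, tvCost S (x.1 ℓ, x.2 ℓ) * F x ∂(resample (q ℓ) ℓ ν) ≤
      ∫⁻ x, (∑ ℓ₂ ∈ nbr ℓ, tvCost S (x.1 ℓ₂, x.2 ℓ₂)) * F x ∂ν := by
  rw [lintegral_resample (q ℓ) ℓ ν (F := fun x => tvCost S (x.1 ℓ, x.2 ℓ) * F x)
    ((measurable_tvCost_coord hΔ ℓ).mul hF)]
  refine lintegral_mono fun p => ?_
  simp only [update_self, hFinv]
  rw [lintegral_mul_const _ (measurable_tvCost hΔ)]
  exact mul_le_mul' (lintegral_tvCost_le_sum_of_local q nbr ℓ hdiag p) le_rfl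

/-! ### (21): the disagreement at the resampled site -/

omit [Fintype ι] in
/-- **(21).** With the good-pair row (10)–(11) and the locality bound, a bad boundary condition is
charged through Markov's inequality `1 − 𝟙_{h ≤ K} ≤ K⁻¹ h`:
`∫ I_ℓ d(R_ℓ ν) ≤ Σ_{ℓ'∈∂ℓ} κ_{ℓℓ'} ∫ I_{ℓ'} dν + K⁻¹ Σ_{ℓ₁,ℓ₂∈∂ℓ} ∫ I_{ℓ₂} (h(x_{ℓ₁}) + h(y_{ℓ₁})) dν`.
[cite: ConacheEtAl2015, Lemma 3.6 (21); resampling map = Presutti2009 §3.2.2 (3.2.2.4)] -/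
theorem dp21 (hΔ : MeasurableSet (Set.diagonal S)) (ℓ : ι)
    (hdiag : ∀ p : (ι → S) × (ι → S), (∀ ℓ' ∈ nbr ℓ, p.1 ℓ' = p.2 ℓ') →
      ∫⁻ s, tvCost S s ∂(q ℓ p) = 0)
    {h : S → ℝ≥0∞} (hh : Measurable h) {K : ℝ≥0∞} (hK0 : K ≠ 0) (hKtop : K ≠ ∞)
    (κ : ι → ι → ℝ≥0∞)
    (hgood : ∀ p : (ι → S) × (ι → S), (∀ ℓ' ∈ nbr ℓ, h (p.1 ℓ') ≤ K) →
      (∀ ℓ' ∈ nbr ℓ, h (p.2 ℓ') ≤ K) →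
      ∫⁻ s, tvCost S s ∂(q ℓ p) ≤ ∑ ℓ' ∈ nbr ℓ, κ ℓ ℓ' * tvCost S (p.1 ℓ', p.2 ℓ'))
    (ν : Measure ((ι → S) × (ι → S))) [SFinite ν] :
    ∫⁻ x, tvCost S (x.1 ℓ, x.2 ℓ) ∂(resample (q ℓ) ℓ ν) ≤
      ∑ ℓ' ∈ nbr ℓ, κ ℓ ℓ' * ∫⁻ x, tvCost S (x.1 ℓ', x.2 ℓ') ∂ν +
        K⁻¹ * ∑ ℓ₁ ∈ nbr ℓ, ∑ ℓ₂ ∈ nbr ℓ,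
          ∫⁻ x, tvCost S (x.1 ℓ₂, x.2 ℓ₂) * (h (x.1 ℓ₁) + h (x.2 ℓ₁)) ∂ν := by
  have hI : ∀ j, Measurable fun x : (ι → S) × (ι → S) => tvCost S (x.1 j, x.2 j) :=
    fun j => measurable_tvCost_coord hΔ j
  have hH : ∀ j, Measurable fun x : (ι → S) × (ι → S) => h (x.1 j) + h (x.2 j) := fun j =>
    (hh.comp ((measurable_pi_apply j).comp measurable_fst)).add
      (hh.comp ((measurable_pi_apply j).comp measurable_snd))
  rw [lintegral_resample (q ℓ) ℓ ν (F := fun x => tvCost S (x.1 ℓ, x.2 ℓ)) (hI ℓ)]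
  simp only [update_self]
  -- pointwise bound on `D(p) = ∫ υ dq_ℓ(p)`
  have hpt : ∀ p : (ι → S) × (ι → S), ∫⁻ s, tvCost S (s.1, s.2) ∂(q ℓ p) ≤
      ∑ ℓ' ∈ nbr ℓ, κ ℓ ℓ' * tvCost S (p.1 ℓ', p.2 ℓ') +
        K⁻¹ * ∑ ℓ₁ ∈ nbr ℓ, ∑ ℓ₂ ∈ nbr ℓ,
          tvCost S (p.1 ℓ₂, p.2 ℓ₂) * (h (p.1 ℓ₁) + h (p.2 ℓ₁)) := by
    intro p
    simp only [Prod.mk.eta]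
    by_cases hg : (∀ ℓ' ∈ nbr ℓ, h (p.1 ℓ') ≤ K) ∧ (∀ ℓ' ∈ nbr ℓ, h (p.2 ℓ') ≤ K)
    · exact (hgood p hg.1 hg.2).trans le_self_add
    · -- a bad neighbour `ℓ₁`: `K⁻¹ (h(x_{ℓ₁}) + h(y_{ℓ₁})) ≥ 1`
      have hbad : ∃ ℓ₁ ∈ nbr ℓ, K < h (p.1 ℓ₁) + h (p.2 ℓ₁) := by
        by_contra hcon
        push Not at hcon
        refine hg ⟨fun ℓ' hℓ' => ?_, fun ℓ' hℓ' => ?_⟩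
        · exact le_self_add.trans (hcon ℓ' hℓ')
        · exact le_add_self.trans (hcon ℓ' hℓ')
      obtain ⟨ℓ₁, hℓ₁, hlt⟩ := hbad
      have hone : 1 ≤ K⁻¹ * (h (p.1 ℓ₁) + h (p.2 ℓ₁)) := by
        calc (1 : ℝ≥0∞) = K⁻¹ * K := (ENNReal.inv_mul_cancel hK0 hKtop).symm
          _ ≤ K⁻¹ * (h (p.1 ℓ₁) + h (p.2 ℓ₁)) := mul_le_mul' le_rfl hlt.le
      calc ∫⁻ s, tvCost S s ∂(q ℓ p)
          ≤ ∑ ℓ₂ ∈ nbr ℓ, tvCost S (p.1 ℓ₂, p.2 ℓ₂) :=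
            lintegral_tvCost_le_sum_of_local q nbr ℓ hdiag p
        _ ≤ K⁻¹ * (h (p.1 ℓ₁) + h (p.2 ℓ₁)) * ∑ ℓ₂ ∈ nbr ℓ, tvCost S (p.1 ℓ₂, p.2 ℓ₂) :=
            le_mul_of_one_le_left' hone
        _ = K⁻¹ * ∑ ℓ₂ ∈ nbr ℓ, tvCost S (p.1 ℓ₂, p.2 ℓ₂) * (h (p.1 ℓ₁) + h (p.2 ℓ₁)) := by
            rw [mul_assoc, mul_sum]
            refine congrArg _ (sum_congr rfl fun ℓ₂ _ => mul_comm _ _)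
        _ ≤ K⁻¹ * ∑ ℓ₁' ∈ nbr ℓ, ∑ ℓ₂ ∈ nbr ℓ,
              tvCost S (p.1 ℓ₂, p.2 ℓ₂) * (h (p.1 ℓ₁') + h (p.2 ℓ₁')) :=
            mul_le_mul' le_rfl (single_le_sum (f := fun ℓ₁' => ∑ ℓ₂ ∈ nbr ℓ,
              tvCost S (p.1 ℓ₂, p.2 ℓ₂) * (h (p.1 ℓ₁') + h (p.2 ℓ₁'))) (fun _ _ => bot_le) hℓ₁)
        _ ≤ _ := le_add_self
  calc ∫⁻ p, ∫⁻ s, tvCost S (s.1, s.2) ∂(q ℓ p) ∂ν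
      ≤ ∫⁻ p, (∑ ℓ' ∈ nbr ℓ, κ ℓ ℓ' * tvCost S (p.1 ℓ', p.2 ℓ') +
          K⁻¹ * ∑ ℓ₁ ∈ nbr ℓ, ∑ ℓ₂ ∈ nbr ℓ,
            tvCost S (p.1 ℓ₂, p.2 ℓ₂) * (h (p.1 ℓ₁) + h (p.2 ℓ₁))) ∂ν := lintegral_mono hpt
    _ = _ := by
        have hA : Measurable fun p : (ι → S) × (ι → S) =>
            ∑ ℓ' ∈ nbr ℓ, κ ℓ ℓ' * tvCost S (p.1 ℓ', p.2 ℓ') :=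
          Finset.measurable_sum _ fun ℓ' _ => (hI ℓ').const_mul _
        have hB1 : ∀ ℓ₁, Measurable fun p : (ι → S) × (ι → S) =>
            ∑ ℓ₂ ∈ nbr ℓ, tvCost S (p.1 ℓ₂, p.2 ℓ₂) * (h (p.1 ℓ₁) + h (p.2 ℓ₁)) :=
          fun ℓ₁ => Finset.measurable_sum _ fun ℓ₂ _ => (hI ℓ₂).mul (hH ℓ₁)
        have hB : Measurable fun p : (ι → S) × (ι → S) => ∑ ℓ₁ ∈ nbr ℓ,
            ∑ ℓ₂ ∈ nbr ℓ, tvCost S (p.1 ℓ₂, p.2 ℓ₂) * (h (p.1 ℓ₁) + h (p.2 ℓ₁)) :=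
          Finset.measurable_sum _ fun ℓ₁ _ => hB1 ℓ₁
        rw [lintegral_add_left hA, lintegral_const_mul _ hB,
          lintegral_finsetSum _ fun ℓ' _ => (hI ℓ').const_mul _,
          lintegral_finsetSum _ fun ℓ₁ _ => hB1 ℓ₁]
        congr 1
        · exact sum_congr rfl fun ℓ' _ => lintegral_const_mul _ (hI ℓ')
        · congr 1
          exact sum_congr rfl fun ℓ₁ _ =>
            lintegral_finsetSum _ fun ℓ₂ _ => (hI ℓ₂).mul (hH ℓ₁)

/-! ### (22): the Lyapunov weight at the resampled site -/

omit [Fintype ι] in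
/-- **(22), first marginal.** For `ℓ₁ ≠ ℓ`, resampling `ℓ` replaces `h(x_ℓ)` by its one-site mean,
controlled by the Lyapunov row (12):
`∫ I_{ℓ₁} h(x_ℓ) d(R_ℓ ν) ≤ ∫ I_{ℓ₁} dν + Σ_{ℓ₂∈∂ℓ} c_{ℓℓ₂} ∫ I_{ℓ₁} h(x_{ℓ₂}) dν`.
[cite: ConacheEtAl2015, Lemma 3.6 (22); resampling map = Presutti2009 §3.2.2 (3.2.2.4)] -/
theorem dp22₁ (hΔ : MeasurableSet (Set.diagonal S)) (ℓ : ι) {h : S → ℝ≥0∞} (hh : Measurable h)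
    (c : ι → ι → ℝ≥0∞)
    (hlyap₁ : ∀ p : (ι → S) × (ι → S),
      ∫⁻ s, h s.1 ∂(q ℓ p) ≤ 1 + ∑ ℓ₂ ∈ nbr ℓ, c ℓ ℓ₂ * h (p.1 ℓ₂))
    {ℓ₁ : ι} (hℓ₁ : ℓ₁ ≠ ℓ) (ν : Measure ((ι → S) × (ι → S))) [SFinite ν] :
    ∫⁻ x, tvCost S (x.1 ℓ₁, x.2 ℓ₁) * h (x.1 ℓ) ∂(resample (q ℓ) ℓ ν) ≤
      ∫⁻ x, tvCost S (x.1 ℓ₁, x.2 ℓ₁) ∂ν +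
        ∑ ℓ₂ ∈ nbr ℓ, c ℓ ℓ₂ * ∫⁻ x, tvCost S (x.1 ℓ₁, x.2 ℓ₁) * h (x.1 ℓ₂) ∂ν := by
  have hI : ∀ j, Measurable fun x : (ι → S) × (ι → S) => tvCost S (x.1 j, x.2 j) :=
    fun j => measurable_tvCost_coord hΔ j
  have hh1 : ∀ j, Measurable fun x : (ι → S) × (ι → S) => h (x.1 j) := fun j =>
    hh.comp ((measurable_pi_apply j).comp measurable_fst)
  rw [lintegral_resample (q ℓ) ℓ ν (F := fun x => tvCost S (x.1 ℓ₁, x.2 ℓ₁) * h (x.1 ℓ))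
    ((hI ℓ₁).mul (hh1 ℓ))]
  simp only [update_self, update_of_ne hℓ₁]
  calc ∫⁻ p, ∫⁻ s, tvCost S (p.1 ℓ₁, p.2 ℓ₁) * h s.1 ∂(q ℓ p) ∂ν
      = ∫⁻ p, tvCost S (p.1 ℓ₁, p.2 ℓ₁) * ∫⁻ s, h s.1 ∂(q ℓ p) ∂ν :=
        lintegral_congr fun p => lintegral_const_mul _ (hh.comp measurable_fst)
    _ ≤ ∫⁻ p, tvCost S (p.1 ℓ₁, p.2 ℓ₁) * (1 + ∑ ℓ₂ ∈ nbr ℓ, c ℓ ℓ₂ * h (p.1 ℓ₂)) ∂ν :=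
        lintegral_mono fun p => mul_le_mul' le_rfl (hlyap₁ p)
    _ = _ := by
        simp_rw [mul_add, mul_one, mul_sum]
        rw [lintegral_add_left (hI ℓ₁),
          lintegral_finsetSum _ fun ℓ₂ _ => (show Measurable (fun x : (ι → S) × (ι → S) =>
            tvCost S (x.1 ℓ₁, x.2 ℓ₁) * (c ℓ ℓ₂ * h (x.1 ℓ₂))) from (hI ℓ₁).mul ((hh1 ℓ₂).const_mul _))]
        congr 1
        refine sum_congr rfl fun ℓ₂ _ => ?_
        rw [← lintegral_const_mul _ (f := fun x : (ι → S) × (ι → S) =>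
          tvCost S (x.1 ℓ₁, x.2 ℓ₁) * h (x.1 ℓ₂)) ((hI ℓ₁).mul (hh1 ℓ₂))]
        exact lintegral_congr fun p => by ring

omit [Fintype ι] in
/-- **(22), second marginal** (the Lyapunov row of the second specification, matrix `c'`).
[cite: ConacheEtAl2015, Lemma 3.6 (22); resampling map = Presutti2009 §3.2.2 (3.2.2.4)] -/
theorem dp22₂ (hΔ : MeasurableSet (Set.diagonal S)) (ℓ : ι) {h : S → ℝ≥0∞} (hh : Measurable h)
    (c' : ι → ι → ℝ≥0∞)
    (hlyap₂ : ∀ p : (ι → S) × (ι → S),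
      ∫⁻ s, h s.2 ∂(q ℓ p) ≤ 1 + ∑ ℓ₂ ∈ nbr ℓ, c' ℓ ℓ₂ * h (p.2 ℓ₂))
    {ℓ₁ : ι} (hℓ₁ : ℓ₁ ≠ ℓ) (ν : Measure ((ι → S) × (ι → S))) [SFinite ν] :
    ∫⁻ x, tvCost S (x.1 ℓ₁, x.2 ℓ₁) * h (x.2 ℓ) ∂(resample (q ℓ) ℓ ν) ≤
      ∫⁻ x, tvCost S (x.1 ℓ₁, x.2 ℓ₁) ∂ν +
        ∑ ℓ₂ ∈ nbr ℓ, c' ℓ ℓ₂ * ∫⁻ x, tvCost S (x.1 ℓ₁, x.2 ℓ₁) * h (x.2 ℓ₂) ∂ν := by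
  have hI : ∀ j, Measurable fun x : (ι → S) × (ι → S) => tvCost S (x.1 j, x.2 j) :=
    fun j => measurable_tvCost_coord hΔ j
  have hh2 : ∀ j, Measurable fun x : (ι → S) × (ι → S) => h (x.2 j) := fun j =>
    hh.comp ((measurable_pi_apply j).comp measurable_snd)
  rw [lintegral_resample (q ℓ) ℓ ν (F := fun x => tvCost S (x.1 ℓ₁, x.2 ℓ₁) * h (x.2 ℓ))
    ((hI ℓ₁).mul (hh2 ℓ))]
  simp only [update_self, update_of_ne hℓ₁]
  calc ∫⁻ p, ∫⁻ s, tvCost S (p.1 ℓ₁, p.2 ℓ₁) * h s.2 ∂(q ℓ p) ∂ν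
      = ∫⁻ p, tvCost S (p.1 ℓ₁, p.2 ℓ₁) * ∫⁻ s, h s.2 ∂(q ℓ p) ∂ν :=
        lintegral_congr fun p => lintegral_const_mul _ (hh.comp measurable_snd)
    _ ≤ ∫⁻ p, tvCost S (p.1 ℓ₁, p.2 ℓ₁) * (1 + ∑ ℓ₂ ∈ nbr ℓ, c' ℓ ℓ₂ * h (p.2 ℓ₂)) ∂ν :=
        lintegral_mono fun p => mul_le_mul' le_rfl (hlyap₂ p)
    _ = _ := by
        simp_rw [mul_add, mul_one, mul_sum]
        rw [lintegral_add_left (hI ℓ₁),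
          lintegral_finsetSum _ fun ℓ₂ _ => (show Measurable (fun x : (ι → S) × (ι → S) =>
            tvCost S (x.1 ℓ₁, x.2 ℓ₁) * (c' ℓ ℓ₂ * h (x.2 ℓ₂))) from (hI ℓ₁).mul ((hh2 ℓ₂).const_mul _))]
        congr 1
        refine sum_congr rfl fun ℓ₂ _ => ?_
        rw [← lintegral_const_mul _ (f := fun x : (ι → S) × (ι → S) =>
          tvCost S (x.1 ℓ₁, x.2 ℓ₁) * h (x.2 ℓ₂)) ((hI ℓ₁).mul (hh2 ℓ₂))]
        exact lintegral_congr fun p => by ring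

/-! ### (24): disagreement and Lyapunov weight at the same, resampled, site -/

omit [Fintype ι] [DecidableEq ι] [∀ ℓ, IsMarkovKernel (q ℓ)] in
/-- Pointwise core of (24): the `q_ℓ(x,y)`-mean of `υ · h` vanishes when `x, y` agree on `∂ℓ`
(locality, `υ = 0` `q`-a.e.) and is at most the mean of `h` otherwise (`υ ≤ 1`); hence it is
`≤ (Σ_{ℓ₁∈∂ℓ} I_{ℓ₁}(x,y)) · ∫ h dq_ℓ(x,y)`. [cite: ConacheEtAl2015, Lemma 3.5 and Lemma 3.6 (24); discrete cost as in Presutti2009 §3.2.3 Cor. 3.2.3.2] -/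
theorem lintegral_tvCost_mul_le_sum_mul (hΔ : MeasurableSet (Set.diagonal S)) (ℓ : ι)
    (hdiag : ∀ p : (ι → S) × (ι → S), (∀ ℓ' ∈ nbr ℓ, p.1 ℓ' = p.2 ℓ') →
      ∫⁻ s, tvCost S s ∂(q ℓ p) = 0)
    {g : S × S → ℝ≥0∞} (hg : Measurable g) (p : (ι → S) × (ι → S)) :
    ∫⁻ s, tvCost S s * g s ∂(q ℓ p) ≤
      (∑ ℓ₁ ∈ nbr ℓ, tvCost S (p.1 ℓ₁, p.2 ℓ₁)) * ∫⁻ s, g s ∂(q ℓ p) := by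
  by_cases hagree : ∀ ℓ' ∈ nbr ℓ, p.1 ℓ' = p.2 ℓ'
  · -- `υ = 0` a.e. under `q_ℓ(p)`
    have hae : (fun s => tvCost S s) =ᵐ[q ℓ p] 0 :=
      (lintegral_eq_zero_iff (measurable_tvCost hΔ)).1 (hdiag p hagree)
    have h0 : ∫⁻ s, tvCost S s * g s ∂(q ℓ p) = 0 := by
      refine (lintegral_eq_zero_iff ((measurable_tvCost hΔ).mul hg)).2 ?_
      filter_upwards [hae] with s hs
      simp [hs]
    rw [h0]; exact bot_le
  · push Not at hagree
    obtain ⟨ℓ', hℓ', hne⟩ := hagree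
    have hone : 1 ≤ ∑ ℓ₁ ∈ nbr ℓ, tvCost S (p.1 ℓ₁, p.2 ℓ₁) := by
      calc (1 : ℝ≥0∞) = tvCost S (p.1 ℓ', p.2 ℓ') := by
            rw [tvCost, indicator_of_mem (by simpa [Set.mem_diagonal_iff] using hne)]; rfl
        _ ≤ _ := single_le_sum (f := fun ℓ₁ => tvCost S (p.1 ℓ₁, p.2 ℓ₁)) (fun _ _ => bot_le) hℓ'
    calc ∫⁻ s, tvCost S s * g s ∂(q ℓ p) ≤ ∫⁻ s, g s ∂(q ℓ p) :=
          lintegral_mono fun s => by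
            calc tvCost S s * g s ≤ 1 * g s := mul_le_mul' (tvCost_le_one s) le_rfl
              _ = g s := one_mul _
      _ ≤ _ := le_mul_of_one_le_left' hone

omit [Fintype ι] in
/-- **(24), first marginal.** `∫ I_ℓ h(x_ℓ) d(R_ℓ ν) ≤ Σ_{ℓ₁∈∂ℓ} ∫ I_{ℓ₁} dν + Σ_{ℓ₁,ℓ₂∈∂ℓ} c_{ℓℓ₂} ∫ I_{ℓ₁} h(x_{ℓ₂}) dν`.
[cite: ConacheEtAl2015, Lemma 3.6 (24); resampling map = Presutti2009 §3.2.2 (3.2.2.4)] -/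
theorem dp24₁ (hΔ : MeasurableSet (Set.diagonal S)) (ℓ : ι)
    (hdiag : ∀ p : (ι → S) × (ι → S), (∀ ℓ' ∈ nbr ℓ, p.1 ℓ' = p.2 ℓ') →
      ∫⁻ s, tvCost S s ∂(q ℓ p) = 0)
    {h : S → ℝ≥0∞} (hh : Measurable h) (c : ι → ι → ℝ≥0∞)
    (hlyap₁ : ∀ p : (ι → S) × (ι → S),
      ∫⁻ s, h s.1 ∂(q ℓ p) ≤ 1 + ∑ ℓ₂ ∈ nbr ℓ, c ℓ ℓ₂ * h (p.1 ℓ₂))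
    (ν : Measure ((ι → S) × (ι → S))) [SFinite ν] :
    ∫⁻ x, tvCost S (x.1 ℓ, x.2 ℓ) * h (x.1 ℓ) ∂(resample (q ℓ) ℓ ν) ≤
      ∑ ℓ₁ ∈ nbr ℓ, ∫⁻ x, tvCost S (x.1 ℓ₁, x.2 ℓ₁) ∂ν +
        ∑ ℓ₁ ∈ nbr ℓ, ∑ ℓ₂ ∈ nbr ℓ, c ℓ ℓ₂ * ∫⁻ x, tvCost S (x.1 ℓ₁, x.2 ℓ₁) * h (x.1 ℓ₂) ∂ν := by
  have hI : ∀ j, Measurable fun x : (ι → S) × (ι → S) => tvCost S (x.1 j, x.2 j) :=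
    fun j => measurable_tvCost_coord hΔ j
  have hh1 : ∀ j, Measurable fun x : (ι → S) × (ι → S) => h (x.1 j) := fun j =>
    hh.comp ((measurable_pi_apply j).comp measurable_fst)
  rw [lintegral_resample (q ℓ) ℓ ν (F := fun x => tvCost S (x.1 ℓ, x.2 ℓ) * h (x.1 ℓ))
    ((hI ℓ).mul (hh1 ℓ))]
  simp only [update_self]
  calc ∫⁻ p, ∫⁻ s, tvCost S (s.1, s.2) * h s.1 ∂(q ℓ p) ∂ν
      ≤ ∫⁻ p, (∑ ℓ₁ ∈ nbr ℓ, tvCost S (p.1 ℓ₁, p.2 ℓ₁)) * ∫⁻ s, h s.1 ∂(q ℓ p) ∂ν := by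
        refine lintegral_mono fun p => ?_
        simpa only [Prod.mk.eta] using
          lintegral_tvCost_mul_le_sum_mul q nbr hΔ ℓ hdiag (g := fun s : S × S => h s.1)
            (hh.comp measurable_fst) p
    _ ≤ ∫⁻ p, (∑ ℓ₁ ∈ nbr ℓ, tvCost S (p.1 ℓ₁, p.2 ℓ₁)) *
          (1 + ∑ ℓ₂ ∈ nbr ℓ, c ℓ ℓ₂ * h (p.1 ℓ₂)) ∂ν :=
        lintegral_mono fun p => mul_le_mul' le_rfl (hlyap₁ p)
    _ = _ := by
        simp_rw [mul_add, mul_one, sum_mul, mul_sum]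
        rw [lintegral_add_left (Finset.measurable_sum _ fun ℓ₁ _ => hI ℓ₁),
          lintegral_finsetSum _ fun ℓ₁ _ => hI ℓ₁,
          lintegral_finsetSum _ fun ℓ₁ _ => (show Measurable (fun x : (ι → S) × (ι → S) =>
            ∑ ℓ₂ ∈ nbr ℓ, tvCost S (x.1 ℓ₁, x.2 ℓ₁) * (c ℓ ℓ₂ * h (x.1 ℓ₂))) from
            Finset.measurable_sum _ fun ℓ₂ _ => (hI ℓ₁).mul ((hh1 ℓ₂).const_mul _))]
        congr 1
        refine sum_congr rfl fun ℓ₁ _ => ?_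
        rw [lintegral_finsetSum _ fun ℓ₂ _ => (show Measurable (fun x : (ι → S) × (ι → S) =>
            tvCost S (x.1 ℓ₁, x.2 ℓ₁) * (c ℓ ℓ₂ * h (x.1 ℓ₂))) from (hI ℓ₁).mul ((hh1 ℓ₂).const_mul _))]
        refine sum_congr rfl fun ℓ₂ _ => ?_
        rw [← lintegral_const_mul _ (f := fun x : (ι → S) × (ι → S) =>
          tvCost S (x.1 ℓ₁, x.2 ℓ₁) * h (x.1 ℓ₂)) ((hI ℓ₁).mul (hh1 ℓ₂))]
        exact lintegral_congr fun p => by ring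

omit [Fintype ι] in
/-- **(24), second marginal.** [cite: ConacheEtAl2015, Lemma 3.6 (24); resampling map = Presutti2009 §3.2.2 (3.2.2.4)] -/
theorem dp24₂ (hΔ : MeasurableSet (Set.diagonal S)) (ℓ : ι)
    (hdiag : ∀ p : (ι → S) × (ι → S), (∀ ℓ' ∈ nbr ℓ, p.1 ℓ' = p.2 ℓ') →
      ∫⁻ s, tvCost S s ∂(q ℓ p) = 0)
    {h : S → ℝ≥0∞} (hh : Measurable h) (c' : ι → ι → ℝ≥0∞)
    (hlyap₂ : ∀ p : (ι → S) × (ι → S),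
      ∫⁻ s, h s.2 ∂(q ℓ p) ≤ 1 + ∑ ℓ₂ ∈ nbr ℓ, c' ℓ ℓ₂ * h (p.2 ℓ₂))
    (ν : Measure ((ι → S) × (ι → S))) [SFinite ν] :
    ∫⁻ x, tvCost S (x.1 ℓ, x.2 ℓ) * h (x.2 ℓ) ∂(resample (q ℓ) ℓ ν) ≤
      ∑ ℓ₁ ∈ nbr ℓ, ∫⁻ x, tvCost S (x.1 ℓ₁, x.2 ℓ₁) ∂ν +
        ∑ ℓ₁ ∈ nbr ℓ, ∑ ℓ₂ ∈ nbr ℓ, c' ℓ ℓ₂ * ∫⁻ x, tvCost S (x.1 ℓ₁, x.2 ℓ₁) * h (x.2 ℓ₂) ∂ν := by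
  have hI : ∀ j, Measurable fun x : (ι → S) × (ι → S) => tvCost S (x.1 j, x.2 j) :=
    fun j => measurable_tvCost_coord hΔ j
  have hh2 : ∀ j, Measurable fun x : (ι → S) × (ι → S) => h (x.2 j) := fun j =>
    hh.comp ((measurable_pi_apply j).comp measurable_snd)
  rw [lintegral_resample (q ℓ) ℓ ν (F := fun x => tvCost S (x.1 ℓ, x.2 ℓ) * h (x.2 ℓ))
    ((hI ℓ).mul (hh2 ℓ))]
  simp only [update_self]
  calc ∫⁻ p, ∫⁻ s, tvCost S (s.1, s.2) * h s.2 ∂(q ℓ p) ∂ν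
      ≤ ∫⁻ p, (∑ ℓ₁ ∈ nbr ℓ, tvCost S (p.1 ℓ₁, p.2 ℓ₁)) * ∫⁻ s, h s.2 ∂(q ℓ p) ∂ν := by
        refine lintegral_mono fun p => ?_
        simpa only [Prod.mk.eta] using
          lintegral_tvCost_mul_le_sum_mul q nbr hΔ ℓ hdiag (g := fun s : S × S => h s.2)
            (hh.comp measurable_snd) p
    _ ≤ ∫⁻ p, (∑ ℓ₁ ∈ nbr ℓ, tvCost S (p.1 ℓ₁, p.2 ℓ₁)) *
          (1 + ∑ ℓ₂ ∈ nbr ℓ, c' ℓ ℓ₂ * h (p.2 ℓ₂)) ∂ν :=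
        lintegral_mono fun p => mul_le_mul' le_rfl (hlyap₂ p)
    _ = _ := by
        simp_rw [mul_add, mul_one, sum_mul, mul_sum]
        rw [lintegral_add_left (Finset.measurable_sum _ fun ℓ₁ _ => hI ℓ₁),
          lintegral_finsetSum _ fun ℓ₁ _ => hI ℓ₁,
          lintegral_finsetSum _ fun ℓ₁ _ => (show Measurable (fun x : (ι → S) × (ι → S) =>
            ∑ ℓ₂ ∈ nbr ℓ, tvCost S (x.1 ℓ₁, x.2 ℓ₁) * (c' ℓ ℓ₂ * h (x.2 ℓ₂))) from
            Finset.measurable_sum _ fun ℓ₂ _ => (hI ℓ₁).mul ((hh2 ℓ₂).const_mul _))]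
        congr 1
        refine sum_congr rfl fun ℓ₁ _ => ?_
        rw [lintegral_finsetSum _ fun ℓ₂ _ => (show Measurable (fun x : (ι → S) × (ι → S) =>
            tvCost S (x.1 ℓ₁, x.2 ℓ₁) * (c' ℓ ℓ₂ * h (x.2 ℓ₂))) from (hI ℓ₁).mul ((hh2 ℓ₂).const_mul _))]
        refine sum_congr rfl fun ℓ₂ _ => ?_
        rw [← lintegral_const_mul _ (f := fun x : (ι → S) × (ι → S) =>
          tvCost S (x.1 ℓ₁, x.2 ℓ₁) * h (x.2 ℓ₂)) ((hI ℓ₁).mul (hh2 ℓ₂))]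
        exact lintegral_congr fun p => by ring

end DobrushinPecherskyStep

end Literature.Probability.TransportMaps

/-!
# Part II — Lemma 3.7 of Dobrushin–Pechersky for one-site total-variation couplings: the sweep of
# `DobrushinPecherskySweep` instantiated on the one-step estimates of Part I
# (Conache–Kondratiev–Kozitsky–Pasurek 2015, §3.3 Lemma 3.7, §4)

[ConacheEtAl2015] D. Conache, Yu. Kondratiev, Yu. Kozitsky, T. Pasurek, arXiv:1501.00673, after
[DobrushinPechersky1983]. The abstract colour-class sweep
(`Literature/Probability/TransportMaps/DobrushinPecherskySweep.lean`: `DPSystem`, `IsDPStep`,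
`Admissible`, `lemma_3_7`) is fed with Part I's realisation of Lemma 3.6 (21)–(24)
(namespace `DobrushinPecherskyStep` above: `dp21`, `dp22₁/₂`, `dp23`,
`dp24₁/₂`) for the resampling maps `R_ℓ ν = DobrushinCouplingCompact.resample (q ℓ) ℓ ν` through ANY
Markov one-site coupling kernels `q ℓ`, the discrete cost `υ = TVDisagreement.tvCost`, and the
functionals `ν(I_ℓ) = ∫ υ(x_ℓ, y_ℓ) dν`, `ν(I_ℓ H^i_{ℓ'}) = ∫ υ(x_ℓ, y_ℓ) h(x^i_{ℓ'}) dν`, `i = 1, 2`.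

* `tvSystem q nbr κ c c' ε h` — the `DPSystem` on probability measures on pairs of configurations
  (marginal index `Fin 2`; Lyapunov matrices `c` for the first, `c'` for the second marginal);
* `isDPStep_tvSystem` — Lemma 3.4 (b) (`lintegral_resample_of_invariant`) and (21)–(24) (`dp21`,
  `dp22₁/₂`, `dp23`, `dp24₁/₂`) ⟹ `IsDPStep`, under the printed hypotheses: LOCALITY of `q_ℓ` in
  `∂ℓ` (Lemma 3.5), the good-pair row (10)–(11) with `K`, the Lyapunov rows (12) for both marginals,
  and `ε = K⁻¹`;
* ★ `lemma_3_7_tv` — for every probability `ν₀` on `(ι → S) × (ι → S)` with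
  `∫ υ(x_ℓ,y_ℓ) dν₀ ≤ γ₀`, `∫ υ(x_ℓ,y_ℓ) h(x^i_{ℓ'}) dν₀ ≤ Λ₀`: the swept law `ν` satisfies
  (27) `∫ υ(x_ℓ,y_ℓ) dν ≤ [κ̄ + AK⁻¹] γ₀ + 2AK⁻¹ Λ₀` and
  (28′) `∫ υ(x_ℓ,y_ℓ) h(x^i_{ℓ'}) dν ≤ Δ^χ γ₀ + c̄Δ^{χ+1} Λ₀`
  (print's (28) has `Δ^{χ−1}`, `c̄Δ^χ`; see the Sweep file's reading note E-DP-1);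
* `isCoupling_sweep_tv` — Lemma 3.4 (a): if `ν₀ ∈ 𝒞(μ₁, μ₂)` and the `q_ℓ` couple one-site kernels
  leaving `μ₁`, `μ₂` invariant (`OneSiteKernels`), the swept law is again in `𝒞(μ₁, μ₂)`.

Scope (honest): finite site set; the printed standing assumptions become explicit hypotheses
(nothing is derived here about WHEN a specification satisfies (10)–(12)); no statement about
lattice gauge theories, continuum limits or mass gaps. No named facts.

## References
* [ConacheEtAl2015] arXiv:1501.00673, Lemma 3.4, Lemma 3.5, Lemma 3.6 (21)–(24), Lemma 3.7
  (27)–(28), §4. Quoted from the held TeX, pp. 8–16.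
* [DobrushinPechersky1983] LNM 1021 (1983) 97–110.
* [Presutti2009] E. Presutti, *Scaling Limits in Statistical Mechanics and Microstructures in
  Continuum Mechanics*, Springer 2009, §3.2.2 (3.2.2.4) (the resampling map).
-/

open MeasureTheory ProbabilityTheory Function Finset

open scoped ENNReal NNReal

namespace Literature.Probability.TransportMaps

namespace DobrushinPecherskySweepTV

open Literature.MeasureTheory.OptimalTransport (IsCoupling)
open DobrushinCouplingCompact (resample lintegral_resample lintegral_resample_of_invariant
  OneSiteKernels map_fst_resample map_snd_resample)
open TVDisagreement (tvCost tvCost_le_one measurable_tvCost measurable_tvCost_coord)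
open DobrushinPecherskySweep DobrushinPecherskyStep

variable {ι : Type*} [Fintype ι] [DecidableEq ι]
variable {S : Type*} [MeasurableSpace S]

/-- The `i`-th marginal configuration of a pair, `i : Fin 2` (print: `x^i`, `i = 1, 2`).
[cite: ConacheEtAl2015, §3.2 (20)] -/
def marg (i : Fin 2) (x : (ι → S) × (ι → S)) : ι → S := if i = 0 then x.1 else x.2

omit [Fintype ι] [DecidableEq ι] [MeasurableSpace S] in
/-- `x¹ = x.1`. [cite: ConacheEtAl2015, §3.2 (20)] -/
@[simp] theorem marg_zero (x : (ι → S) × (ι → S)) : marg 0 x = x.1 := rfl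

omit [Fintype ι] [DecidableEq ι] [MeasurableSpace S] in
/-- `x² = x.2`. [cite: ConacheEtAl2015, §3.2 (20)] -/
@[simp] theorem marg_one (x : (ι → S) × (ι → S)) : marg 1 x = x.2 := rfl

omit [Fintype ι] [DecidableEq ι] in
/-- `x ↦ h(x^i_j)` is measurable. [cite: ConacheEtAl2015, §3.2 (20)] -/
theorem measurable_h_marg {h : S → ℝ≥0∞} (hh : Measurable h) (i : Fin 2) (j : ι) :
    Measurable fun x : (ι → S) × (ι → S) => h (marg i x j) := by
  fin_cases i
  · exact hh.comp ((measurable_pi_apply j).comp measurable_fst)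
  · exact hh.comp ((measurable_pi_apply j).comp measurable_snd)

variable (q : ι → Kernel ((ι → S) × (ι → S)) (S × S)) [∀ ℓ, IsMarkovKernel (q ℓ)]
variable (nbr : ι → Finset ι) (κ : ι → ι → ℝ≥0∞) (c c' : ι → ι → ℝ≥0∞) (ε : ℝ≥0) (h : S → ℝ≥0∞)

/-- **The Dobrushin–Pechersky system of one-site TV couplings.** States: probability measures on
pairs of configurations; `R_ℓ ν = resample (q ℓ) ℓ ν` (16); `ν(I_ℓ) = ∫ 𝟙{x_ℓ ≠ y_ℓ} dν`,
`ν(I_ℓ H^i_{ℓ'}) = ∫ 𝟙{x_ℓ ≠ y_ℓ} h(x^i_{ℓ'}) dν` (19)–(20); Lyapunov matrix `c` for the first and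
`c'` for the second marginal; `ε = K⁻¹`. [cite: ConacheEtAl2015, §3.1 (16), §3.2 (19)–(20)] -/
def tvSystem : DPSystem ι (ProbabilityMeasure ((ι → S) × (ι → S))) (Fin 2) where
  nbr := nbr
  κ := κ
  c := fun i => if i = 0 then c else c'
  ε := ε
  R := fun ℓ ν => ⟨resample (q ℓ) ℓ (ν : Measure ((ι → S) × (ι → S))), inferInstance⟩
  γf := fun ν ℓ => ∫⁻ x, tvCost S (x.1 ℓ, x.2 ℓ) ∂(ν : Measure ((ι → S) × (ι → S)))
  Λ := fun ν i ℓ ℓ' =>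
    ∫⁻ x, tvCost S (x.1 ℓ, x.2 ℓ) * h (marg i x ℓ') ∂(ν : Measure ((ι → S) × (ι → S)))

omit [Fintype ι] in
/-- The neighbourhoods of `tvSystem`. [cite: ConacheEtAl2015, §2.1 (1)] -/
@[simp] theorem tvSystem_nbr : (tvSystem q nbr κ c c' ε h).nbr = nbr := rfl

omit [Fintype ι] in
/-- The maps of `tvSystem` are the resamplings (16). [cite: ConacheEtAl2015, §3.1 (16)] -/
@[simp] theorem tvSystem_R_coe (ℓ : ι) (ν : ProbabilityMeasure ((ι → S) × (ι → S))) :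
    (((tvSystem q nbr κ c c' ε h).R ℓ ν : ProbabilityMeasure ((ι → S) × (ι → S))) :
      Measure ((ι → S) × (ι → S))) = resample (q ℓ) ℓ (ν : Measure ((ι → S) × (ι → S))) := rfl

variable {q nbr κ c c' ε h}

omit [Fintype ι] in
/-- **Lemma 3.4 (b) + Lemma 3.6 for TV couplings ⟹ `IsDPStep`.** Hypotheses (print): locality of
`q_ℓ` in `∂ℓ` (Lemma 3.5: boundary conditions agreeing on `∂ℓ` ⇒ no disagreement charged), the
good-pair row (10)–(11), the Lyapunov rows (12) for both marginals, `ε = K⁻¹` with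
`0 < K < ∞`. [cite: ConacheEtAl2015, Lemma 3.4 (b), Lemma 3.5, Lemma 3.6 (21)–(24)] -/
theorem isDPStep_tvSystem (hΔ : MeasurableSet (Set.diagonal S)) (hh : Measurable h)
    (hdiag : ∀ ℓ (p : (ι → S) × (ι → S)), (∀ ℓ' ∈ nbr ℓ, p.1 ℓ' = p.2 ℓ') →
      ∫⁻ s, tvCost S s ∂(q ℓ p) = 0)
    {K : ℝ≥0∞} (hK0 : K ≠ 0) (hKtop : K ≠ ∞) (hε : (ε : ℝ≥0∞) = K⁻¹)
    (hgood : ∀ ℓ (p : (ι → S) × (ι → S)), (∀ ℓ' ∈ nbr ℓ, h (p.1 ℓ') ≤ K) →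
      (∀ ℓ' ∈ nbr ℓ, h (p.2 ℓ') ≤ K) →
      ∫⁻ s, tvCost S s ∂(q ℓ p) ≤ ∑ ℓ' ∈ nbr ℓ, κ ℓ ℓ' * tvCost S (p.1 ℓ', p.2 ℓ'))
    (hlyap₁ : ∀ ℓ (p : (ι → S) × (ι → S)),
      ∫⁻ s, h s.1 ∂(q ℓ p) ≤ 1 + ∑ ℓ₂ ∈ nbr ℓ, c ℓ ℓ₂ * h (p.1 ℓ₂))
    (hlyap₂ : ∀ ℓ (p : (ι → S) × (ι → S)),
      ∫⁻ s, h s.2 ∂(q ℓ p) ≤ 1 + ∑ ℓ₂ ∈ nbr ℓ, c' ℓ ℓ₂ * h (p.2 ℓ₂)) :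
    (tvSystem q nbr κ c c' ε h).IsDPStep where
  γ_of_ne ν ℓ ℓ' hne := by
    change ∫⁻ x, tvCost S (x.1 ℓ', x.2 ℓ') ∂(resample (q ℓ) ℓ _) ≤ _
    exact (DobrushinCouplingCompact.lintegral_siteCost_resample_of_ne (q ℓ) (Ne.symm hne) _
      (measurable_tvCost hΔ)).le
  Λ_of_ne ν i ℓ ℓ₁ ℓ₂ h₁ h₂ := by
    change ∫⁻ x, tvCost S (x.1 ℓ₁, x.2 ℓ₁) * h (marg i x ℓ₂) ∂(resample (q ℓ) ℓ _) ≤ _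
    refine (lintegral_resample_of_invariant (q ℓ) ℓ _
      ((measurable_tvCost_coord hΔ ℓ₁).mul (measurable_h_marg hh i ℓ₂)) ?_).le
    intro ω ω' s s'
    fin_cases i <;> simp [marg, update_of_ne h₁, update_of_ne h₂]
  h21 ν ℓ := by
    change ∫⁻ x, tvCost S (x.1 ℓ, x.2 ℓ) ∂(resample (q ℓ) ℓ _) ≤ _
    refine (dp21 q nbr hΔ ℓ (hdiag ℓ) hh hK0 hKtop κ (hgood ℓ) _).trans (le_of_eq ?_)
    have hI : ∀ j, Measurable fun x : (ι → S) × (ι → S) => tvCost S (x.1 j, x.2 j) :=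
      fun j => measurable_tvCost_coord hΔ j
    have key : ∀ ℓ₁ ℓ₂, ∫⁻ x, tvCost S (x.1 ℓ₂, x.2 ℓ₂) * (h (x.1 ℓ₁) + h (x.2 ℓ₁))
          ∂(ν : Measure ((ι → S) × (ι → S))) =
        ∑ i : Fin 2, ∫⁻ x, tvCost S (x.1 ℓ₂, x.2 ℓ₂) * h (marg i x ℓ₁)
          ∂(ν : Measure ((ι → S) × (ι → S))) := by
      intro ℓ₁ ℓ₂
      rw [Fin.sum_univ_two]
      simp only [marg_zero, marg_one, mul_add]
      exact lintegral_add_left ((hI ℓ₂).mul (measurable_h_marg hh 0 ℓ₁)) _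
    simp only [tvSystem, key, hε]
    congr 2
    symm
    rw [Finset.sum_comm]
    exact Finset.sum_congr rfl fun ℓ₁ _ => Finset.sum_comm
  h22 ν i ℓ ℓ₁ hℓ₁ := by
    change ∫⁻ x, tvCost S (x.1 ℓ₁, x.2 ℓ₁) * h (marg i x ℓ) ∂(resample (q ℓ) ℓ _) ≤ _
    fin_cases i
    · simpa [tvSystem, marg] using dp22₁ q nbr hΔ ℓ hh c (hlyap₁ ℓ) hℓ₁ _
    · simpa [tvSystem, marg] using dp22₂ q nbr hΔ ℓ hh c' (hlyap₂ ℓ) hℓ₁ _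
  h23 ν i ℓ ℓ₁ hℓ₁ := by
    change ∫⁻ x, tvCost S (x.1 ℓ, x.2 ℓ) * h (marg i x ℓ₁) ∂(resample (q ℓ) ℓ _) ≤ _
    have hI : ∀ j, Measurable fun x : (ι → S) × (ι → S) => tvCost S (x.1 j, x.2 j) :=
      fun j => measurable_tvCost_coord hΔ j
    refine (dp23 q nbr hΔ ℓ (hdiag ℓ) _ (measurable_h_marg hh i ℓ₁) ?_).trans (le_of_eq ?_)
    · intro ω ω' s s'
      fin_cases i <;> simp [marg, update_of_ne hℓ₁]
    · simp only [tvSystem, Finset.sum_mul]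
      exact lintegral_finsetSum _ fun ℓ₂ _ => (hI ℓ₂).mul (measurable_h_marg hh i ℓ₁)
  h24 ν i ℓ := by
    change ∫⁻ x, tvCost S (x.1 ℓ, x.2 ℓ) * h (marg i x ℓ) ∂(resample (q ℓ) ℓ _) ≤ _
    fin_cases i
    · simpa [tvSystem, marg] using dp24₁ q nbr hΔ ℓ (hdiag ℓ) hh c (hlyap₁ ℓ) _
    · simpa [tvSystem, marg] using dp24₂ q nbr hΔ ℓ (hdiag ℓ) hh c' (hlyap₂ ℓ) _

/-- **Lemma 3.7 for one-site TV couplings (one sweep).** With the hypotheses of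
`isDPStep_tvSystem`, admissible constants (`Δ ≥ 2`, `#∂ℓ ≤ Δ`, `Σκ ≤ κ̄ ≤ 1`, `Σc, Σc' ≤ c̄`,
`c̄Δ^χ ≤ 1`, `2α ≤ c̄`, `2Δ^{χ+1}ε + ακ̄ ≤ α` where `α = AK⁻¹`), a proper `χ`-colouring, and a
probability `ν₀` on pairs with `∫ 𝟙{x_ℓ≠y_ℓ} dν₀ ≤ γ₀`, `∫ 𝟙{x_ℓ≠y_ℓ} h(x^i_{ℓ'}) dν₀ ≤ Λ₀`: the
swept law `ν` obeys (27) `∫ 𝟙{x_ℓ≠y_ℓ} dν ≤ [κ̄ + AK⁻¹]γ₀ + 2AK⁻¹Λ₀` and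
(28′) `∫ 𝟙{x_ℓ≠y_ℓ} h(x^i_{ℓ'}) dν ≤ Δ^χ γ₀ + c̄Δ^{χ+1} Λ₀`.
[cite: ConacheEtAl2015, Lemma 3.7 (27)–(28), §4] -/
theorem lemma_3_7_tv (hstep : (tvSystem q nbr κ c c' ε h).IsDPStep) {Δ χ : ℕ}
    {κbar cbar α : ℝ≥0} (hA : (tvSystem q nbr κ c c' ε h).Admissible Δ χ κbar cbar α)
    {col : ι → Fin χ} (hcol : ∀ ℓ, ∀ ℓ' ∈ nbr ℓ, col ℓ' ≠ col ℓ) {γ₀ Λ₀ : ℝ≥0∞}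
    {ν₀ : ProbabilityMeasure ((ι → S) × (ι → S))}
    (hγ : ∀ ℓ, ∫⁻ x, tvCost S (x.1 ℓ, x.2 ℓ) ∂(ν₀ : Measure ((ι → S) × (ι → S))) ≤ γ₀)
    (hΛ : ∀ (i : Fin 2) ℓ ℓ', ∫⁻ x, tvCost S (x.1 ℓ, x.2 ℓ) * h (marg i x ℓ')
      ∂(ν₀ : Measure ((ι → S) × (ι → S))) ≤ Λ₀) :
    (∀ ℓ, ∫⁻ x, tvCost S (x.1 ℓ, x.2 ℓ)
        ∂(((tvSystem q nbr κ c c' ε h).sweep col ν₀ : ProbabilityMeasure _) :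
          Measure ((ι → S) × (ι → S))) ≤ ((κbar : ℝ≥0∞) + α) * γ₀ + 2 * (α : ℝ≥0∞) * Λ₀) ∧
      ∀ (i : Fin 2) ℓ ℓ', ∫⁻ x, tvCost S (x.1 ℓ, x.2 ℓ) * h (marg i x ℓ')
        ∂(((tvSystem q nbr κ c c' ε h).sweep col ν₀ : ProbabilityMeasure _) :
          Measure ((ι → S) × (ι → S))) ≤
        (Δ : ℝ≥0∞) ^ χ * γ₀ + (cbar : ℝ≥0∞) * (Δ : ℝ≥0∞) ^ (χ + 1) * Λ₀ :=
  (tvSystem q nbr κ c c' ε h).lemma_3_7 hstep hA (by simpa using hcol) hγ hΛ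

/-- **Lemma 3.4 (a) along the sweep:** if the `q_ℓ` couple one-site kernels `γ_ℓ, γ'_ℓ` leaving
`μ₁, μ₂` invariant and `ν₀ ∈ 𝒞(μ₁, μ₂)`, then the swept law is in `𝒞(μ₁, μ₂)`.
[cite: ConacheEtAl2015, Lemma 3.4 (a), Lemma 3.7] -/
theorem isCoupling_sweep_tv {μ₁ μ₂ : Measure (ι → S)} {γ γ' : ι → Kernel (ι → S) S}
    [∀ i, IsMarkovKernel (γ i)] [∀ i, IsMarkovKernel (γ' i)]
    (hK : OneSiteKernels μ₁ μ₂ γ γ' q) {χ : ℕ} (col : ι → Fin χ)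
    {ν₀ : ProbabilityMeasure ((ι → S) × (ι → S))}
    (h₀ : IsCoupling μ₁ μ₂ (ν₀ : Measure ((ι → S) × (ι → S)))) :
    IsCoupling μ₁ μ₂ (((tvSystem q nbr κ c c' ε h).sweep col ν₀ : ProbabilityMeasure _) :
      Measure ((ι → S) × (ι → S))) := by
  refine (tvSystem q nbr κ c c' ε h).sweep_induction
    (fun ν : ProbabilityMeasure ((ι → S) × (ι → S)) =>
      IsCoupling μ₁ μ₂ (ν : Measure ((ι → S) × (ι → S)))) ?_ col h₀
  intro ℓ ν hν
  exact ⟨map_fst_resample hK ℓ hν.map_fst, map_snd_resample hK ℓ hν.map_snd⟩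

end DobrushinPecherskySweepTV

end Literature.Probability.TransportMaps
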